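import Summits.HubbardSuperconductivity.HubbardLadder.NeelMarshallInfraredFloor
import Summits.HubbardSuperconductivity.HubbardLadder.NeelFoldedTables
import Summits.HubbardSuperconductivity.HubbardLadder.NeelRPCorrelationWindowTablesFour
import Summits.HubbardSuperconductivity.HubbardLadder.NeelMarshallFloorRows
import HarnessLib

/-!
# R2 device D20 — the fold-by-4 Marshall–infrared floor `m_s²(L) ≥ 2.6202/L²` for EVERY `L ∈ 4ℕ`

HONEST FRAMING: ladder R1–R4 with certified numbers; no claim on H/H₀. Cell pub-hubbard, seat r2
(gen 13). Each theorem is a statement about ONE finite matrix (the spin-½ Heisenberg antiferromagnet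
`heisenbergTorus 2 L 1 J` on the `L×L` torus); none bears on H₀: the floor decays like `1/L²`.

An ENERGY-FREE, SOLVER-FREE lower bound on the R2 observable `m_s²(L) = neelOrderParamSq L J =
3ĝ_Q/L²`, UNIFORM over the sides `L` divisible by `4`: **`m_s²(L) ≥ 2.6202/L²`**
(`neelOrderParamSq_ge_fold_four`), from `ĝ_Q ≥ 0.8734` (`heisStructureFactor_neel_ge_fold_four`; the
exact value of the folded programme is `0.873414509…`, i.e. `L² m_s² ≥ 2.6202435…`). Compare the
fold-by-2 closed form `1.8288/L²` (`NeelMarshallInfraredFloor`) and the Marshall floor `1.5/L²`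
(D8).

METHOD (tables and dictionary: `NeelFoldedTables`). Sum the reduced two-point function `c(a,b)` over
the `16` residue classes mod `4`, `F(ρ) = Σ_(a≡ρ₁, b≡ρ₂) c(a,b)`. The in-tree inputs — Marshall's
sign rule on the classes (M), `F(0,0) ≥ c(0,0) = ¼` (T), `F(ρ) ≤ c(0,±1), c(±1,0)` for the four
classes of the unit vectors, the singlet rule `Σ F = ĝ_0 = 0` and the Kennedy–Lieb–Shastry `T = 0`
infrared bound in tangent form at the momenta `(2π/4)(s₁,s₂)` with RATIONAL tangent points (I), the
bond correlation `ε` FREE — are the same finitely many linear inequalities in the `18` unknowns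
`F(ρ), c(0,1), c(1,0)` for every such `L`, and ONE `linarith` certificate closes. Tangent points
(momentum ↦ g₀): (0, 1) ↦ 9/76, (0, 2) ↦ 8/39, (1, 0) ↦ 9/76, (1, 1) ↦ 8/39, (1, 2) ↦ 27/76, (1, 3)
↦ 8/39, (2, 0) ↦ 8/39, (2, 1) ↦ 27/76.

Rows (R2-TABLE §A8-M, column "fold-4 floor", hypothesis-free): `m_s²(16) ≥ 0.0102` (in-tree
energy-free: Marshall `0.0058`, `NeelMarshallFloorRows`; fold-2 `0.0071`), `m_s²(20) ≥ 0.0065`,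
`m_s²(28) ≥ 0.0033`, `m_s²(32) ≥ 0.0025`; QMC comparators (never inputs) `≈ 0.13, 0.12, 0.11, 0.11`
(Sandvik 1997).

References: T. Kennedy, E. H. Lieb, B. S. Shastry, J. Stat. Phys. 53 (1988) 1019, eqs. (12)–(19), p.
1021; E. Lieb, D. Mattis, J. Math. Phys. 3 (1962) 749, Thm 2; W. Marshall, Proc. Roy. Soc. A 232
(1955) 48; A. W. Sandvik, Phys. Rev. B 56 (1997) 11678 (comparators only).
-/

noncomputable section

open Finset Literature.MathematicalPhysics.QuantumLattice Literature.Probability.LatticeModels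

namespace Summit.HubbardSuperconductivity.HubbardLadder

set_option maxHeartbeats 4000000 in
/-- **The structure factor at `Q` is at least `0.8734` on every `2n × 2n` torus with `4 ∣ 2n`, `n ≥ 2`**
(spin ½; the fold-by-4 energy-free KLS programme with Marshall signs; exact value `0.873414509…`).
HONEST FRAMING: ladder R1–R4 with certified numbers; no claim on H/H₀.
[cite: KLS1988JSP, eqs. (12)–(19)] [cite: LiebMattis1962, Theorem 2] -/
theorem heisStructureFactor_neel_ge_fold_four (n m : ℕ) (hn : 2 ≤ n) (hL : 2 * n = m * 4) :
    (0.8734 : ℝ) ≤ heisStructureFactor 0 (2 * n) 1 (neelIndex (2 * n) : TorusSite 2 (2 * n)) := by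
  haveI : NeZero (2 * n) := ⟨by omega⟩
  have hm : m ≠ 0 := by omega
  obtain ⟨F, hF⟩ : ∃ F : ℕ → ℕ → ℝ, ∀ ρ₁ ρ₂, F ρ₁ ρ₂ =
      ∑ a ∈ (range (2 * n)).filter (fun a => a % 4 = ρ₁),
        ∑ b ∈ (range (2 * n)).filter (fun b => b % 4 = ρ₂), heisRedCorr2 (2 * n) 1 a b :=
    ⟨_, fun _ _ => rfl⟩
  obtain ⟨cw0, cw1, cw2, cw3⟩ := cosW_4
  have k2 : (2 : ℕ) ∣ 4 := by norm_num
  -- (Z) singlet rule and (T) the class of the origin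
  have hZ := fold_singlet n m 4 hn hL (by norm_num) F hF
  have hT := foldClass_zero_zero_ge n 4 F hF k2
  -- (M) Marshall signs of the classes
  have hM_0_1 := foldClass_nonpos n 4 F hF k2 0 1 (by norm_num)
  have hM_0_2 := foldClass_nonneg n 4 F hF k2 0 2 (by norm_num)
  have hM_0_3 := foldClass_nonpos n 4 F hF k2 0 3 (by norm_num)
  have hM_1_0 := foldClass_nonpos n 4 F hF k2 1 0 (by norm_num)
  have hM_1_1 := foldClass_nonneg n 4 F hF k2 1 1 (by norm_num)
  have hM_1_2 := foldClass_nonpos n 4 F hF k2 1 2 (by norm_num)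
  have hM_1_3 := foldClass_nonneg n 4 F hF k2 1 3 (by norm_num)
  have hM_2_0 := foldClass_nonneg n 4 F hF k2 2 0 (by norm_num)
  have hM_2_1 := foldClass_nonpos n 4 F hF k2 2 1 (by norm_num)
  have hM_2_2 := foldClass_nonneg n 4 F hF k2 2 2 (by norm_num)
  have hM_2_3 := foldClass_nonpos n 4 F hF k2 2 3 (by norm_num)
  have hM_3_0 := foldClass_nonpos n 4 F hF k2 3 0 (by norm_num)
  have hM_3_1 := foldClass_nonneg n 4 F hF k2 3 1 (by norm_num)
  have hM_3_2 := foldClass_nonpos n 4 F hF k2 3 2 (by norm_num)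
  have hM_3_3 := foldClass_nonneg n 4 F hF k2 3 3 (by norm_num)
  -- (M') the four classes of the unit vectors are bounded by single correlations
  have hS01 := foldClass_le_single n 4 F hF k2 0 1 0 1 (by norm_num) (by omega) (by norm_num)
    (by omega) (by norm_num)
  have hS0p := foldClass_le_single n 4 F hF k2 0 3 0 (2 * n - 1) (by norm_num) (by omega)
    (by norm_num) (by omega) (by omega)
  rw [heisRedCorr2_zero_pred n (by omega)] at hS0p
  have hS10 := foldClass_le_single n 4 F hF k2 1 0 1 0 (by norm_num) (by omega) (by norm_num)
    (by omega) (by norm_num)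
  have hSp0 := foldClass_le_single n 4 F hF k2 3 0 (2 * n - 1) 0 (by norm_num) (by omega)
    (by omega) (by omega) (by norm_num)
  rw [heisRedCorr2_pred_zero n (by omega)] at hSp0
  obtain ⟨hN01, hN10⟩ := heisRedCorr2_unit_nonpos n
  -- (I) the infrared bound in tangent form at rational tangent points; `ε = (c(1,0)+c(0,1))/2` is free
  have hε := heisBondCorr_two_eq (2 * n) 1
  have hI_0_1 := ir_fold_tangent n m 4 0 1 hn hL (by norm_num) (by norm_num) (by omega)
    (by norm_num [cw0, cw1, cw2, cw3]) F hF (9/76)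
  have hI_0_2 := ir_fold_tangent n m 4 0 2 hn hL (by norm_num) (by norm_num) (by omega)
    (by norm_num [cw0, cw1, cw2, cw3]) F hF (8/39)
  have hI_1_0 := ir_fold_tangent n m 4 1 0 hn hL (by norm_num) (by norm_num) (by omega)
    (by norm_num [cw0, cw1, cw2, cw3]) F hF (9/76)
  have hI_1_1 := ir_fold_tangent n m 4 1 1 hn hL (by norm_num) (by norm_num) (by omega)
    (by norm_num [cw0, cw1, cw2, cw3]) F hF (8/39)
  have hI_1_2 := ir_fold_tangent n m 4 1 2 hn hL (by norm_num) (by norm_num) (by omega)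
    (by norm_num [cw0, cw1, cw2, cw3]) F hF (27/76)
  have hI_1_3 := ir_fold_tangent n m 4 1 3 hn hL (by norm_num) (by norm_num) (by omega)
    (by norm_num [cw0, cw1, cw2, cw3]) F hF (8/39)
  have hI_2_0 := ir_fold_tangent n m 4 2 0 hn hL (by norm_num) (by norm_num) (by omega)
    (by norm_num [cw0, cw1, cw2, cw3]) F hF (8/39)
  have hI_2_1 := ir_fold_tangent n m 4 2 1 hn hL (by norm_num) (by norm_num) (by omega)
    (by norm_num [cw0, cw1, cw2, cw3]) F hF (27/76)
  rw [hε] at hI_0_1 hI_0_2 hI_1_0 hI_1_1 hI_1_2 hI_1_3 hI_2_0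
  rw [hε] at hI_2_1
  -- the objective `ĝ_Q` as a signed class sum, then one linear certificate
  rw [heisStructureFactor_neel_fold n m 4 2 hL (by omega) hm (by norm_num) F hF]
  simp only [sum_range_succ, sum_range_zero, zero_add] at hZ hI_0_1 hI_0_2 hI_1_0 hI_1_1 hI_1_2 hI_1_3
  simp only [sum_range_succ, sum_range_zero, zero_add] at hI_2_0 hI_2_1 ⊢
  norm_num [cw0, cw1, cw2, cw3] at hZ hI_0_1 hI_0_2 hI_1_0 hI_1_1 hI_1_2 hI_1_3
  norm_num [cw0, cw1, cw2, cw3] at hI_2_0 hI_2_1 ⊢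
  linarith

/-- **R2 device D20, uniform row: `m_s²(L) ≥ 2.6202/L²`** for every `L` divisible by `4` and every
`J > 0` (energy-free, solver-free; fold-by-4 Marshall-augmented KLS programme). A statement about each
finite torus; decays like `1/L²`; no bearing on H₀.
HONEST FRAMING: ladder R1–R4 with certified numbers; no claim on H/H₀.
[cite: KLS1988JSP, eqs. (12)–(19)] [cite: LiebMattis1962, Theorem 2] -/
theorem neelOrderParamSq_ge_fold_four (L : ℕ) [NeZero L] (hL : 4 ∣ L) {J : ℝ} (hJ : 0 < J) :
    (2.6202 : ℝ) / (L : ℝ) ^ 2 ≤ neelOrderParamSq L J := by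
  obtain ⟨m, hm⟩ := hL
  have hL0 := NeZero.ne L
  obtain ⟨n, rfl⟩ : ∃ n, L = 2 * n := ⟨L / 2, by omega⟩
  have hG := heisStructureFactor_neel_ge_fold_four n m (by omega) (by omega)
  rw [neelOrderParamSq_two_mul_eq n hJ]
  have hpos : (0 : ℝ) < ((2 * n : ℕ) : ℝ) := by positivity
  rw [show (2.6202 : ℝ) / ((2 * n : ℕ) : ℝ) ^ 2 = 3 * ((2.6202 / 3) / ((2 * n : ℕ) : ℝ) ^ 2) by ring]
  gcongr
  linarith

/-! ### Rows (R2-TABLE §A8-M, column "fold-4 floor"; hypothesis-free) -/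

/-- From the uniform floor: `c · L² ≤ 2.6202` gives `c ≤ m_s²(L)`. [folklore] -/
private theorem row_of_fold_four {L : ℕ} [NeZero L] (hL : 4 ∣ L) {J : ℝ} (hJ : 0 < J) {c : ℝ}
    (hc : c * (L : ℝ) ^ 2 ≤ 2.6202) : c ≤ neelOrderParamSq L J := by
  have h := neelOrderParamSq_ge_fold_four L hL hJ
  have hL0 : (0 : ℝ) < (L : ℝ) := by exact_mod_cast Nat.pos_of_ne_zero (NeZero.ne L)
  exact le_trans (by rw [le_div_iff₀ (by positivity)]; exact hc) h

/-- Row A8.16 (fold-4 column): `0.0102 ≤ m_s²(16)` for every `J > 0` (`2.6202/256`); energy-free;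
no claim on H/H₀. [cite: KLS1988JSP, eqs. (12)–(19)] [cite: LiebMattis1962, Theorem 2] -/
theorem neelOrderParamSq_sixteen_ge_fold_four (J : ℝ) (hJ : 0 < J) :
    (0.0102 : ℝ) ≤ neelOrderParamSq 16 J :=
  row_of_fold_four (by norm_num) hJ (by norm_num)

/-- Row A8.20 (fold-4 column): `0.0065 ≤ m_s²(20)` for every `J > 0` (`2.6202/400`); energy-free;
no claim on H/H₀. [cite: KLS1988JSP, eqs. (12)–(19)] [cite: LiebMattis1962, Theorem 2] -/
theorem neelOrderParamSq_twenty_ge_fold_four (J : ℝ) (hJ : 0 < J) :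
    (0.0065 : ℝ) ≤ neelOrderParamSq 20 J :=
  row_of_fold_four (by norm_num) hJ (by norm_num)

/-- Row A8.28 (fold-4 column): `0.0033 ≤ m_s²(28)` for every `J > 0` (`2.6202/784`); energy-free;
no claim on H/H₀. [cite: KLS1988JSP, eqs. (12)–(19)] [cite: LiebMattis1962, Theorem 2] -/
theorem neelOrderParamSq_twentyEight_ge_fold_four (J : ℝ) (hJ : 0 < J) :
    (0.0033 : ℝ) ≤ neelOrderParamSq 28 J :=
  row_of_fold_four (by norm_num) hJ (by norm_num)

/-- Row A8.32 (fold-4 column): `0.0025 ≤ m_s²(32)` for every `J > 0` (`2.6202/1024`); energy-free;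
no claim on H/H₀. [cite: KLS1988JSP, eqs. (12)–(19)] [cite: LiebMattis1962, Theorem 2] -/
theorem neelOrderParamSq_thirtyTwo_ge_fold_four (J : ℝ) (hJ : 0 < J) :
    (0.0025 : ℝ) ≤ neelOrderParamSq 32 J :=
  row_of_fold_four (by norm_num) hJ (by norm_num)

/-- Two-sided kernel bracket at `L = 16`: `m_s²(16) ∈ [0.0102, 0.254]` for every `J > 0` (no
hypothesis; the upper end is the operator ceiling `neelOrderParamSq_sixteen_le`; QMC comparator `≈ 0.13`).
[cite: KLS1988JSP, eqs. (12)–(19)] [cite: Tasaki2020, §2.2] -/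
theorem neelOrderParamSq_sixteen_mem_Icc_fold (J : ℝ) (hJ : 0 < J) :
    neelOrderParamSq 16 J ∈ Set.Icc (0.0102 : ℝ) 0.254 :=
  ⟨neelOrderParamSq_sixteen_ge_fold_four J hJ, neelOrderParamSq_sixteen_le J⟩

end Summit.HubbardSuperconductivity.HubbardLadder
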